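import Mathlib
import Literature.MathematicalPhysics.QuantumLattice.HubbardRectangularTorus
import HarnessLib

/-!
# Relabelling Fock vectors along an arbitrary site bijection: sectors and sector ground states

Topic `Literature/MathematicalPhysics/QuantumLattice`; companion of `FermionRelabelling.lean`
(`relabel e`, the Bogoliubov automorphism `a ↦ Γ_e a Γ_e⁻¹` of an orbital bijection `e : ι ≃ ι'`,
`relabel_hamiltonian`), `ProjectedBCSStateReal.lean` / `HubbardRectangularTorus.lean`
(`relabelVec e`, the signed permutation `Γ_e` of Fock VECTORS, `relabelVecInv`,
`relabel_mulVec_relabelVec`, `star_relabelVec_dotProduct`, `isNParticle_relabelVec`,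
`groundEnergy_relabel`) and `FockRelabel.lean` (the same transport, but for PERMUTATIONS of one
orbital type only: `IsGroundStateInSector.fockRelabel_mapEquiv_mulVec`). For a site bijection
`f : Λ ≃ Λ'` between DIFFERENT site types (e.g. the square torus `FermionTorus 2 L` and the
diagonal tube `Fin L ×ₗ Fin L`, `squareToRect L`) this file proves, sorry-free:

* `relabelVec` is linear and injective (`relabelVec_smul`, `relabelVec_zero`,
  `relabelVec_injective`), and `Γ_e ψ` is `N`-particle only if `ψ` is
  (`isNParticle_of_relabelVec`);
* `S^z` is covariant under `Orb.mapEquiv f` (`relabel_mapEquiv_spinZ_equiv`), so the joint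
  `(N, S^z)` sectors `szSector N M` are transported both ways (`mem_szSector_relabelVec`,
  `mem_szSector_of_relabelVec_mem`);
* the sector energies are invariant, `E_{(N,M)}(Γ H Γ⁻¹) = E_{(N,M)}(H)`
  (`minEnergyOn_relabel_szSector`), and sector ground states of `H` go to sector ground states
  of `Γ H Γ⁻¹` (`IsGroundStateInSector.relabelVec`).

No definition and no named fact is introduced.

## Mathlib / tree search

`lean search 'relabelVec_smul|relabelVec_injective|minEnergyOn_relabel|szSector_relabelVec'`
found nothing (2026-08-16); the permutation-only versions are in `FockRelabel.lean`.

## References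

O. Bratteli, D. W. Robinson, *Operator Algebras and Quantum Statistical Mechanics II* (1997),
§5.2.2, Thm. 5.2.5 (one-particle bijections are unitarily implemented on Fock space); E. H. Lieb,
PRL 62 (1989) 1201 (the joint `(N, S^z)` sectors of the Hubbard model).
-/

noncomputable section

namespace Literature.MathematicalPhysics.QuantumLattice

open Matrix Finset

/-! ### Signed-permutation transport of vectors, sectors and sector ground states -/

section RelabelVecGeneral

variable {ι ι' : Type*} [LinearOrder ι] [LinearOrder ι']

/-- The relabelling sign never vanishes (`ε = ±1`). [folklore] -/
theorem relabelSign_ne_zero (e : ι ≃ ι') (s : Finset ι) : relabelSign e s ≠ 0 := by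
  simp [relabelSign]

/-- `Γ_e` is linear: `Γ (c • ψ) = c • Γ ψ`. [folklore] -/
theorem relabelVec_smul (e : ι ≃ ι') (c : ℂ) (ψ : Fock ι) :
    relabelVec e (c • ψ) = c • relabelVec e ψ := by
  funext t
  simp [relabelVec, mul_left_comm]

/-- `Γ_e 0 = 0`. [folklore] -/
theorem relabelVec_zero (e : ι ≃ ι') : relabelVec e (0 : Fock ι) = 0 := by
  funext t
  simp [relabelVec]

/-- `Γ_e` is injective. [folklore] -/
theorem relabelVec_injective (e : ι ≃ ι') : Function.Injective (relabelVec e) := by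
  intro ψ₁ ψ₂ h
  funext s
  have h' := congrFun h (e.finsetCongr s)
  rw [relabelVec_apply_finsetCongr, relabelVec_apply_finsetCongr] at h'
  exact mul_left_cancel₀ (relabelSign_ne_zero e s) h'

/-- If `Γ_e ψ` lies in the `N`-particle sector, so does `ψ`. [folklore] -/
theorem isNParticle_of_relabelVec (e : ι ≃ ι') {N : ℕ} {ψ : Fock ι}
    (h : IsNParticle N (relabelVec e ψ)) : IsNParticle N ψ := by
  intro s hs
  have h' := h (e.finsetCongr s) (by rwa [Equiv.finsetCongr_apply, Finset.card_map])
  rw [relabelVec_apply_finsetCongr] at h'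
  exact (mul_eq_zero.1 h').resolve_left (relabelSign_ne_zero e s)

end RelabelVecGeneral

section Sectors

variable {Λ Λ' : Type*} [LinearOrder Λ] [Fintype Λ] [LinearOrder Λ'] [Fintype Λ']

/-- **`S^z` is covariant under arbitrary site bijections** `f : Λ ≃ Λ'`:
`Γ_f S^z_Λ Γ_f⁻¹ = S^z_{Λ'}` (the permutation version is `relabel_mapEquiv_spinZ`). [folklore] -/
theorem relabel_mapEquiv_spinZ_equiv (f : Λ ≃ Λ') :
    relabel (Orb.mapEquiv f) (HubbardWave0.spinZ : Matrix (Finset (Orb Λ)) (Finset (Orb Λ)) ℂ) =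
      HubbardWave0.spinZ := by
  rw [HubbardWave0.spinZ, HubbardWave0.spinZ, map_smul, map_sum]
  simp_rw [map_sub, relabel_mapEquiv_numberOp]
  congr 1
  exact Equiv.sum_comp f (fun x' => numberOp x' 0 - numberOp x' 1)

/-- `Γ_f` maps the joint `(N, S^z = M)` sector of `Λ` into that of `Λ'`. [folklore] -/
theorem mem_szSector_relabelVec (f : Λ ≃ Λ') {N : ℕ} {M : ℝ} {ψ : Fock (Orb Λ)}
    (hψ : ψ ∈ szSector N M) : relabelVec (Orb.mapEquiv f) ψ ∈ szSector N M := by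
  rw [mem_szSector_iff] at hψ ⊢
  refine ⟨isNParticle_relabelVec _ hψ.1, ?_⟩
  have h := congrArg (relabelVec (Orb.mapEquiv f)) hψ.2
  rw [← relabel_mulVec_relabelVec, relabel_mapEquiv_spinZ_equiv, relabelVec_smul] at h
  exact h

/-- Conversely, if `Γ_f ψ` lies in the joint sector then so does `ψ`. [folklore] -/
theorem mem_szSector_of_relabelVec_mem (f : Λ ≃ Λ') {N : ℕ} {M : ℝ} {ψ : Fock (Orb Λ)}
    (h : relabelVec (Orb.mapEquiv f) ψ ∈ szSector N M) : ψ ∈ szSector N M := by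
  rw [mem_szSector_iff] at h ⊢
  refine ⟨isNParticle_of_relabelVec _ h.1, ?_⟩
  apply relabelVec_injective (Orb.mapEquiv f)
  rw [← relabel_mulVec_relabelVec, relabel_mapEquiv_spinZ_equiv, relabelVec_smul]
  exact h.2

/-- **Sector energies are invariant under site bijections**:
`E_{(N,M)}(Γ_f H Γ_f⁻¹) = E_{(N,M)}(H)` (the signed permutation maps the unit sphere of the sector
onto that of the relabelled sector, preserving expectations).
[cite: BratteliRobinsonII1997, §5.2.2, Thm. 5.2.5] -/
theorem minEnergyOn_relabel_szSector (f : Λ ≃ Λ') (H : Matrix (Finset (Orb Λ)) (Finset (Orb Λ)) ℂ)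
    (N : ℕ) (M : ℝ) :
    (relabel (Orb.mapEquiv f) H).minEnergyOn (szSector N M) = H.minEnergyOn (szSector N M) := by
  unfold Matrix.minEnergyOn
  congr 1
  ext E
  constructor
  · rintro ⟨ψ', hmem, h1, rfl⟩
    have hψ' : relabelVec (Orb.mapEquiv f) (relabelVecInv (Orb.mapEquiv f) ψ') = ψ' :=
      relabelVec_relabelVecInv _ ψ'
    refine ⟨relabelVecInv (Orb.mapEquiv f) ψ', ?_, ?_, ?_⟩
    · apply mem_szSector_of_relabelVec_mem f
      rw [hψ']
      exact hmem
    · rw [← star_relabelVec_dotProduct (Orb.mapEquiv f), hψ', h1]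
    · rw [← hψ', relabel_mulVec_relabelVec, star_relabelVec_dotProduct, hψ']
  · rintro ⟨ψ, hmem, h1, rfl⟩
    exact ⟨relabelVec (Orb.mapEquiv f) ψ, mem_szSector_relabelVec f hmem,
      by rw [star_relabelVec_dotProduct, h1],
      by rw [relabel_mulVec_relabelVec, star_relabelVec_dotProduct]⟩

/-- **Sector ground states are transported**: if `ψ` is a ground state of `H` in the sector
`(N, S^z = M)`, then `Γ_f ψ` is one of `Γ_f H Γ_f⁻¹` in the same sector (for any site bijection
`f`). [cite: BratteliRobinsonII1997, §5.2.2, Thm. 5.2.5] -/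
theorem IsGroundStateInSector.relabelVec (f : Λ ≃ Λ')
    {H : Matrix (Finset (Orb Λ)) (Finset (Orb Λ)) ℂ} {N : ℕ} {M : ℝ} {ψ : Fock (Orb Λ)}
    (hψ : IsGroundStateInSector H N M ψ) :
    IsGroundStateInSector (relabel (Orb.mapEquiv f) H) N M (relabelVec (Orb.mapEquiv f) ψ) := by
  obtain ⟨hmem, hne, heig⟩ := hψ
  refine ⟨mem_szSector_relabelVec f hmem, fun h0 => hne ?_, ?_⟩
  · apply relabelVec_injective (Orb.mapEquiv f)
    rw [h0, relabelVec_zero]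
  · rw [relabel_mulVec_relabelVec, heig, relabelVec_smul, minEnergyOn_relabel_szSector]

end Sectors

end Literature.MathematicalPhysics.QuantumLattice

end
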